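import Summits.Ventures.PercRepro.RankLevelSetAbsorbStarThreeExcess

/-! # RankLevelSetAbsorbStarLarge — EVERY STEP `k` OF (ABS-star) HOLDS FOR EVERY `y` IN NO PARALLEL PAIR AS SOON AS
`#E ≥ k² − k + 1`: `(#E − 1 − k) · A^y_k ≤ k · A^y_{k+1}` (night-1 g34; dossier §46.13)

For a finite matroid `M` on `n = #E` elements and `y ∈ E` with `y ∉ cl {z}` for every `z ≠ y` (no loop, no
parallel partner), the uniform spreading of `RankLevelSetAbsorbStarThree` works at EVERY level `k` once `n` is large:
each member `Z ∈ A^y_k` has `#upNbrs Z = n − k − 1 − #excess Z ≥ n − 2k` up-neighbours (`card_upNbrs_eq`,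
`card_exFinset_le`), a member `W ∈ A^y_{k+1}` has at most `k − 1` down-neighbours — the fundamental circuit
`C_y(W)` has at least three elements when `y` has no parallel partner, and none of its elements other than `y` is
removable (**`card_downNbrs_le`**) — and a down-neighbour with FULL excess `k − 1` is the only one
(**`downNbrs_eq_singleton_of_full_excess`**: its excess together with `y` spans `cl Z ⊇ Z`, so every other element
of `W` lies in `cl (E ∖ W)`). Hence the weights `1/#upNbrs Z` of the down-neighbours of `W` sum to at most
`(k − 1)/(n − k − 1 − (k − 2))` (two or more of them) or `1/(n − 2k)` (one), both `≤ k/(n − k − 1)` when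
`n ≥ k² − k + 1` (`sum_wt_downNbrs_le_of_sq`), and the double count gives **`absorbStar_step_of_sq`**. So (ABS-star)
holds for non-parallel `y` at every step `k ≤ √n`, in particular at every step of every such `(M, y)` for `k ≤ 3`
(`RankLevelSetAbsorbStarThree`) and, for each fixed `k`, for all but finitely many `n`. (The bound is the exact
range of the uniform spreading: the census of dossier §46.5′ shows it failing at `k = 4, n = 10 < 13`.) Nothing here
asserts (ABS-star); every declaration has a docstring; imports: the cell's own modules and Mathlib only. Axioms:
standard. -/

namespace PercRepro

open Set Matroid

variable {α : Type} [DecidableEq α] (M : Matroid α) [M.Finite]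

/-! ## The fundamental circuit of `y` in a member has at least three elements; its elements are not removable -/

open Classical in
/-- The elements `x ∈ W` of the fundamental circuit of `y` in `W` (as a `Finset`). -/
noncomputable def circElems (y : α) (W : Finset α) : Finset α :=
  W.filter (fun x => x ∈ M.fundCircuit y (↑W : Set α))

omit [DecidableEq α] [M.Finite] in
/-- Membership in `circElems`. -/
lemma mem_circElems {y : α} {W : Finset α} {x : α} :
    x ∈ circElems M y W ↔ x ∈ W ∧ x ∈ M.fundCircuit y (↑W : Set α) := by
  simp [circElems]

/-- An element of `W` in the fundamental circuit of `y` has `y ∉ cl (W ∖ {x})`. -/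
lemma notMem_closure_erase_of_mem_fundCircuit {y : α} (hy : y ∈ M.E) {k : ℕ} {W : Finset α}
    (hW : W ∈ absorbFinset M y (k + 1)) {x : α} (hxW : x ∈ W) (hx : x ∈ M.fundCircuit y (↑W : Set α)) :
    y ∉ M.closure (↑(W.erase x) : Set α) := by
  have hW' := (mem_absorbFinset M).mp hW
  have hycl : y ∈ M.closure (↑W : Set α) := mem_closure_of_mem_lowAbsorbAt M hy hW'
  have hyW : y ∉ (↑W : Set α) := hW'.2.1
  rw [(hW'.1.2.2.1).mem_fundCircuit_iff hycl hyW] at hx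
  have hxy : x ≠ y := fun h => hyW (h ▸ Finset.mem_coe.mpr hxW)
  have heq : insert y (↑W : Set α) \ {x} = insert y (↑(W.erase x) : Set α) := by
    rw [Finset.coe_erase, Set.insert_sdiff_of_notMem _ (by simpa using hxy.symm)]
  rw [heq] at hx
  have hind : M.Indep (↑(W.erase x) : Set α) := hW'.1.2.2.1.subset (by simp)
  rw [hind.insert_indep_iff_of_notMem (fun h => hyW (Finset.mem_coe.mpr (Finset.mem_of_mem_erase (Finset.mem_coe.mp h))))] at hx
  exact hx.2

omit [DecidableEq α] in
/-- **For `y` in no parallel pair, the fundamental circuit of `y` in a member `W` has at least two elements of `W`**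
(`circElems`): the circuit is not `{y}` (`y` is not a loop) and not `{y, z}` (`y ∉ cl {z}`). -/
lemma two_le_card_circElems {y : α} (hy : y ∈ M.E) (hnp : ∀ z, z ≠ y → y ∉ M.closure {z}) {k : ℕ}
    {W : Finset α} (hW : W ∈ absorbFinset M y (k + 1)) : 2 ≤ (circElems M y W).card := by
  have hW' := (mem_absorbFinset M).mp hW
  have hycl : y ∈ M.closure (↑W : Set α) := mem_closure_of_mem_lowAbsorbAt M hy hW'
  have hyW : y ∉ (↑W : Set α) := hW'.2.1
  set C := M.fundCircuit y (↑W : Set α) with hC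
  have hCc : M.IsCircuit C := hW'.1.2.2.1.fundCircuit_isCircuit hycl hyW
  have hyC : y ∈ C := M.mem_fundCircuit y _
  have hCsub : C ⊆ insert y (↑W : Set α) := M.fundCircuit_subset_insert y _
  -- `C` is finite with at least three elements, so `C ∖ {y}` has at least two
  have hCfin : C.Finite := (Set.toFinite (insert y (↑W : Set α))).subset hCsub
  have h3 : 3 ≤ C.ncard := by
    by_contra hlt
    push Not at hlt
    have hne : C.ncard ≠ 0 := Set.ncard_ne_zero_of_mem hyC hCfin
    rcases (show C.ncard = 1 ∨ C.ncard = 2 by omega) with h1 | h2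
    · obtain ⟨x, hx⟩ := Set.ncard_eq_one.mp h1
      rw [hx] at hyC; rw [Set.mem_singleton_iff] at hyC; subst hyC
      exact hCc.not_indep (by rw [hx]; exact indep_singleton_of_mem_lowAbsorbAt M hy hW')
    · obtain ⟨a, b, hab, hCab⟩ := Set.ncard_eq_two.mp h2
      have hmem := hCc.mem_closure_sdiff_singleton_of_mem hyC
      rw [hCab] at hyC hmem
      rcases hyC with rfl | rfl
      · rw [Set.pair_sdiff_left hab] at hmem
        exact hnp b hab.symm hmem
      · rw [Set.pair_sdiff_right hab] at hmem
        exact hnp a hab hmem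
  have h2 : 1 < (C \ {y}).ncard := by
    rw [Set.ncard_sdiff_singleton_of_mem hyC]; omega
  obtain ⟨a, b, ha, hb, hab⟩ := (Set.one_lt_ncard_iff (hCfin.subset Set.sdiff_subset)).mp h2
  have hsub : ∀ x ∈ C \ {y}, x ∈ circElems M y W := by
    intro x hx
    have hxW : x ∈ (↑W : Set α) := by
      rcases Set.mem_insert_iff.mp (hCsub hx.1) with h | h
      · exact absurd h hx.2
      · exact h
    rw [mem_circElems]
    exact ⟨Finset.mem_coe.mp hxW, hx.1⟩
  exact Finset.one_lt_card.mpr ⟨a, hsub a ha, b, hsub b hb, hab⟩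

/-- **A member at level `k + 1` has at most `k − 1` down-neighbours when `y` is in no parallel pair.** -/
lemma card_downNbrs_le {y : α} (hy : y ∈ M.E) (hnp : ∀ z, z ≠ y → y ∉ M.closure {z}) {k : ℕ}
    {W : Finset α} (hW : W ∈ absorbFinset M y (k + 1)) : (downNbrs M y k W).card + 2 ≤ k + 1 := by
  have hW' := (mem_absorbFinset M).mp hW
  have hWk : W.card = k + 1 := by have := hW'.1.2.1; rwa [Set.ncard_coe_finset] at this
  have h2 := two_le_card_circElems M hy hnp hW
  have hcsub : circElems M y W ⊆ W := fun x hx => ((mem_circElems M).mp hx).1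
  -- every down-neighbour is `W.erase e` with `e ∈ W ∖ circElems`
  have hsub : downNbrs M y k W ⊆ (W \ circElems M y W).image (fun e => W.erase e) := by
    intro Z hZ
    obtain ⟨e, heW, rfl, -⟩ := exists_erase_of_mem_downNbrs M hW hZ
    rw [Finset.mem_image]
    refine ⟨e, Finset.mem_sdiff.mpr ⟨heW, fun hec => ?_⟩, rfl⟩
    have hZA := (Finset.mem_filter.mp hZ).1
    have hycl := mem_closure_of_mem_lowAbsorbAt M hy ((mem_absorbFinset M).mp hZA)
    rw [mem_circElems] at hec
    exact notMem_closure_erase_of_mem_fundCircuit M hy hW heW hec.2 hycl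
  have h1 := (Finset.card_le_card hsub).trans Finset.card_image_le
  have h3 := Finset.card_le_card hcsub
  rw [Finset.card_sdiff_of_subset hcsub, hWk] at h1
  rw [hWk] at h3
  omega

/-! ## Full excess forces a unique down-neighbour (every level) -/

/-- **A down-neighbour with full excess `k − 1` is the only down-neighbour**: its excess together with `y` is an
independent `k`-set spanning the rank-`k` flat `cl Z ⊇ Z`, and it lies in `E ∖ W`; so every `e' ∈ Z` is in
`cl (E ∖ W)` and `W.erase e' ∉ A^y_k`. -/
lemma downNbrs_eq_singleton_of_full_excess {y : α} (hy : y ∈ M.E) {k : ℕ} {W : Finset α}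
    (hW : W ∈ absorbFinset M y (k + 1)) {Z : Finset α} (hZ : Z ∈ downNbrs M y k W)
    (hfull : (exFinset M y Z).card + 1 = k) : downNbrs M y k W = {Z} := by
  obtain ⟨e, heW, rfl, heZ⟩ := exists_erase_of_mem_downNbrs M hW hZ
  have hW' := (mem_absorbFinset M).mp hW
  have hZA : W.erase e ∈ absorbFinset M y k := (Finset.mem_filter.mp hZ).1
  have hZ' := (mem_absorbFinset M).mp hZA
  have hZk : (W.erase e).card = k := by have := hZ'.1.2.1; rwa [Set.ncard_coe_finset] at this
  have hycl : y ∈ M.closure (↑(W.erase e) : Set α) := mem_closure_of_mem_lowAbsorbAt M hy hZ'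
  have hyW : y ∉ W := by simpa using hW'.2.1
  set X := exFinset M y (W.erase e) with hX
  have hecl : e ∉ M.closure (↑(W.erase e) : Set α) := by
    intro h
    have hind := hW'.1.2.2.1
    rw [← Finset.insert_erase heW, Finset.coe_insert,
      (hZ'.1.2.2.1).insert_indep_iff_of_notMem (fun h => heZ (Finset.mem_coe.mp h))] at hind
    exact hind.2 h
  -- `insert y X ⊆ E ∖ W`
  have hXW : ∀ f ∈ X, f ∉ W := by
    intro f hf hfW
    rw [hX, mem_exFinset] at hf
    rcases Finset.mem_insert.mp ((Finset.insert_erase heW).symm ▸ hfW) with rfl | h'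
    · exact hecl hf.1
    · exact hf.2.2 h'
  have hsubc : (insert y (↑X : Set α)) ⊆ M.E \ ↑W := by
    intro x hx
    rcases Set.mem_insert_iff.mp hx with rfl | hx'
    · exact ⟨hy, by simpa using hyW⟩
    · have hx'' := (mem_exFinset M).mp (Finset.mem_coe.mp hx')
      exact ⟨M.closure_subset_ground _ hx''.1, by simpa using hXW x (Finset.mem_coe.mp hx')⟩
  have hind : M.Indep (insert y (↑X : Set α)) := hW'.1.2.2.2.subset hsubc
  have hsubcl : insert y (↑X : Set α) ⊆ M.closure (↑(W.erase e) : Set α) :=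
    Set.insert_subset hycl (fun x hx => ((mem_exFinset M).mp (Finset.mem_coe.mp hx)).1)
  have hyX : y ∉ (↑X : Set α) := fun h => ((mem_exFinset M).mp (Finset.mem_coe.mp h)).2.1 rfl
  -- every `e' ∈ W.erase e` lies in `cl (insert y X) ⊆ cl (E ∖ W)`
  have hZcl : ∀ e' ∈ W.erase e, e' ∈ M.closure (M.E \ ↑W) := by
    intro e' he'
    have he'cl : e' ∈ M.closure (↑(W.erase e) : Set α) := M.subset_closure _ hZ'.1.1 (Finset.mem_coe.mpr he')
    have he'E : e' ∈ M.E := hZ'.1.1 (Finset.mem_coe.mpr he')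
    by_contra hno
    have hno' : e' ∉ M.closure (insert y (↑X : Set α)) := fun h => hno (M.closure_subset_closure hsubc h)
    have he'nm : e' ∉ insert y (↑X : Set α) :=
      fun h => hno' (M.subset_closure _ (hsubc.trans Set.sdiff_subset) h)
    have hind2 : M.Indep (insert e' (insert y (↑X : Set α))) :=
      (hind.insert_indep_iff_of_notMem he'nm).mpr ⟨he'E, hno'⟩
    have h1 := hind2.encard_le_eRk_of_subset (Set.insert_subset he'cl hsubcl)
    rw [M.eRk_closure_eq, (hZ'.1.2.2.1).eRk_eq_encard, Set.encard_coe_eq_coe_finsetCard, hZk,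
      Set.encard_insert_of_notMem he'nm, Set.encard_insert_of_notMem hyX, Set.encard_coe_eq_coe_finsetCard] at h1
    have h2 : k + 2 ≤ k := by
      have : ((X.card : ℕ∞) + 1 + 1 : ℕ∞) ≤ (k : ℕ∞) := h1
      have h3 : ((X.card + 1 + 1 : ℕ) : ℕ∞) ≤ (k : ℕ∞) := by push_cast; exact this
      have := (Nat.cast_le (α := ℕ∞)).mp h3
      omega
    omega
  ext Z'
  rw [Finset.mem_singleton]
  constructor
  · intro hZ'mem
    obtain ⟨e', he'W, rfl, he'Z'⟩ := exists_erase_of_mem_downNbrs M hW hZ'mem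
    by_contra hne
    have he'ne : e' ≠ e := fun h => hne (by rw [h])
    have he'Z : e' ∈ W.erase e := Finset.mem_erase.mpr ⟨he'ne, he'W⟩
    have hmem := (Finset.mem_filter.mp hZ'mem).1
    have hZ'' := (mem_absorbFinset M).mp hmem
    have hcind := hZ''.1.2.2.2
    have hcompl : M.E \ (↑(W.erase e') : Set α) = insert e' (M.E \ ↑W) := by
      rw [Finset.coe_erase]
      ext x
      simp only [Set.mem_sdiff, Set.mem_insert_iff, Set.mem_singleton_iff, Finset.mem_coe]
      constructor
      · rintro ⟨hxE, hx⟩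
        by_cases hxe : x = e'
        · exact Or.inl hxe
        · exact Or.inr ⟨hxE, fun hxW => hx ⟨hxW, hxe⟩⟩
      · rintro (rfl | ⟨hxE, hxW⟩)
        · exact ⟨hZ'.1.1 (Finset.mem_coe.mpr he'Z), fun h => h.2 rfl⟩
        · exact ⟨hxE, fun h => hxW h.1⟩
    rw [hcompl, (hW'.1.2.2.2).insert_indep_iff_of_notMem (fun h => h.2 (Finset.mem_coe.mpr he'W))] at hcind
    exact hcind.2 (hZcl e' he'Z)
  · rintro rfl
    exact hZ

/-! ## The weights at level `k`, the per-`W` bound for `#E ≥ k² − k + 1`, and the theorem -/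

/-- **The weight of a member at level `k`**: `1 / #upNbrs Z`. -/
noncomputable def wtk (y : α) (k : ℕ) (Z : Finset α) : ℚ := 1 / ((upNbrs M y k Z).card : ℚ)

/-- **The up-neighbour counts of the down-neighbours of `W`**: at least `#E − 2k`, and at least `#E − 2k + 1` when
`W` has two or more down-neighbours (a full excess would make it the only one). -/
lemma card_upNbrs_ge_of_mem_downNbrs {y : α} (hy : y ∈ M.E) {k : ℕ} {W : Finset α}
    (hW : W ∈ absorbFinset M y (k + 1)) {Z : Finset α} (hZ : Z ∈ downNbrs M y k W) :
    M.E.ncard ≤ (upNbrs M y k Z).card + 2 * k ∧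
      (2 ≤ (downNbrs M y k W).card → M.E.ncard + 1 ≤ (upNbrs M y k Z).card + 2 * k) := by
  have hZA : Z ∈ absorbFinset M y k := (Finset.mem_filter.mp hZ).1
  have h1 := card_upNbrs_eq M hy hZA
  have h2 := card_exFinset_le M hy hZA
  refine ⟨by omega, fun hcard => ?_⟩
  have hex : (exFinset M y Z).card + 2 ≤ k := by
    by_contra hno
    push Not at hno
    have hfull : (exFinset M y Z).card + 1 = k := by omega
    have := downNbrs_eq_singleton_of_full_excess M hy hW hZ hfull
    rw [this, Finset.card_singleton] at hcard
    omega
  omega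

/-- **The per-`W` bound for `#E ≥ k² − k + 1`**: for `y` in no parallel pair, `2k + 1 ≤ #E` and `k² − k + 1 ≤ #E`,
the weights of the down-neighbours of a member `W` at level `k + 1` sum to at most `k / (#E − k − 1)`. -/
lemma sum_wtk_downNbrs_le_of_sq {y : α} (hy : y ∈ M.E) (hnp : ∀ z, z ≠ y → y ∉ M.closure {z}) {k : ℕ}
    (hk1 : 1 ≤ k) (hk : 2 * k + 1 ≤ M.E.ncard) (hsq : k * k - k + 1 ≤ M.E.ncard) {W : Finset α}
    (hW : W ∈ absorbFinset M y (k + 1)) :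
    ∑ Z ∈ downNbrs M y k W, wtk M y k Z ≤ (k : ℚ) / ((M.E.ncard : ℚ) - k - 1) := by
  set n := M.E.ncard with hn
  have hnq : (2 * k + 1 : ℚ) ≤ (n : ℚ) := by exact_mod_cast hk
  have hsqq : ((k * k - k + 1 : ℕ) : ℚ) ≤ (n : ℚ) := by exact_mod_cast hsq
  have hsq' : (k : ℚ) * k - k + 1 ≤ (n : ℚ) := by
    have hkk : k ≤ k * k := Nat.le_mul_self k
    rw [Nat.cast_add, Nat.cast_sub hkk, Nat.cast_mul] at hsqq
    simpa using hsqq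
  have hkq : (1 : ℚ) ≤ k := by exact_mod_cast hk1
  have hposI : (0 : ℚ) < (n : ℚ) - k - 1 := by linarith
  have hdle := card_downNbrs_le M hy hnp hW
  rcases Nat.lt_or_ge (downNbrs M y k W).card 1 with h0 | h1
  · have : downNbrs M y k W = ∅ := Finset.card_eq_zero.mp (by omega)
    rw [this, Finset.sum_empty]
    positivity
  rcases Nat.lt_or_ge (downNbrs M y k W).card 2 with h1' | h2
  · -- one down-neighbour: `1/#up ≤ 1/(n − 2k) ≤ k/(n − k − 1)` since `n − k − 1 ≥ k`
    obtain ⟨Z, hZeq⟩ := Finset.card_eq_one.mp (by omega : (downNbrs M y k W).card = 1)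
    have hZ : Z ∈ downNbrs M y k W := by rw [hZeq]; simp
    obtain ⟨hu, -⟩ := card_upNbrs_ge_of_mem_downNbrs M hy hW hZ
    have hu' : (n : ℚ) - 2 * k ≤ ((upNbrs M y k Z).card : ℚ) := by
      have : (n : ℚ) ≤ ((upNbrs M y k Z).card : ℚ) + 2 * k := by exact_mod_cast hu
      linarith
    have hpos2 : (0 : ℚ) < (n : ℚ) - 2 * k := by linarith
    rw [hZeq, Finset.sum_singleton, wtk]
    calc (1 : ℚ) / ((upNbrs M y k Z).card : ℚ) ≤ 1 / ((n : ℚ) - 2 * k) := one_div_le_one_div_of_le hpos2 hu'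
      _ ≤ (k : ℚ) / ((n : ℚ) - k - 1) := by
          rw [div_le_div_iff₀ hpos2 hposI]; nlinarith
  · -- two or more down-neighbours (at most `k − 1`): each weight `≤ 1/(n − 2k + 1)`
    have hpos3 : (0 : ℚ) < (n : ℚ) - 2 * k + 1 := by linarith
    have hbound : ∀ Z ∈ downNbrs M y k W, wtk M y k Z ≤ 1 / ((n : ℚ) - 2 * k + 1) := by
      intro Z hZ
      obtain ⟨-, hu⟩ := card_upNbrs_ge_of_mem_downNbrs M hy hW hZ
      have hu' := hu h2
      have hu'' : (n : ℚ) - 2 * k + 1 ≤ ((upNbrs M y k Z).card : ℚ) := by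
        have : (n : ℚ) + 1 ≤ ((upNbrs M y k Z).card : ℚ) + 2 * k := by exact_mod_cast hu'
        linarith
      exact one_div_le_one_div_of_le hpos3 hu''
    calc ∑ Z ∈ downNbrs M y k W, wtk M y k Z ≤ ∑ _Z ∈ downNbrs M y k W, (1 / ((n : ℚ) - 2 * k + 1)) :=
          Finset.sum_le_sum hbound
      _ = ((downNbrs M y k W).card : ℚ) * (1 / ((n : ℚ) - 2 * k + 1)) := by
          rw [Finset.sum_const, nsmul_eq_mul]
      _ ≤ ((k : ℚ) - 1) * (1 / ((n : ℚ) - 2 * k + 1)) := by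
          have hd : ((downNbrs M y k W).card : ℚ) ≤ (k : ℚ) - 1 := by
            have : ((downNbrs M y k W).card + 2 : ℚ) ≤ (k + 1 : ℚ) := by exact_mod_cast hdle
            linarith
          exact mul_le_mul_of_nonneg_right hd (by positivity)
      _ = ((k : ℚ) - 1) / ((n : ℚ) - 2 * k + 1) := by ring
      _ ≤ (k : ℚ) / ((n : ℚ) - k - 1) := by
          rw [div_le_div_iff₀ hpos3 hposI]; nlinarith

/-- **Every member at level `k` distributes weight exactly `1` over its up-neighbours** (`2k + 1 ≤ #E`). -/
lemma sum_wtk_upNbrs {y : α} (hy : y ∈ M.E) {k : ℕ} (hk : 2 * k + 1 ≤ M.E.ncard) {Z : Finset α}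
    (hZ : Z ∈ absorbFinset M y k) :
    ∑ W ∈ absorbFinset M y (k + 1), (if Z ⊆ W then wtk M y k Z else 0) = 1 := by
  rw [← Finset.sum_filter]
  have hsum : ∑ W ∈ (absorbFinset M y (k + 1)).filter (fun W => Z ⊆ W), wtk M y k Z
      = ((upNbrs M y k Z).card : ℚ) * wtk M y k Z := by
    rw [Finset.sum_const, nsmul_eq_mul]; rfl
  rw [hsum, wtk]
  have hpos : (0 : ℚ) < ((upNbrs M y k Z).card : ℚ) := by
    have h1 := card_upNbrs_eq M hy hZ
    have h2 := card_exFinset_le M hy hZ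
    have : 1 ≤ (upNbrs M y k Z).card := by omega
    exact_mod_cast this
  field_simp

/-- **EVERY STEP `k ≥ 1` OF (ABS-star) HOLDS FOR `y` IN NO PARALLEL PAIR AS SOON AS `#E ≥ k² − k + 1`** (and
`2k + 1 ≤ #E`): `(#E − 1 − k) · A^y_k ≤ k · A^y_{k+1}`. -/
theorem absorbStar_step_of_sq {y : α} (hy : y ∈ M.E) (hnp : ∀ z, z ≠ y → y ∉ M.closure {z}) {k : ℕ}
    (hk1 : 1 ≤ k) (hk : 2 * k + 1 ≤ M.E.ncard) (hsq : k * k - k + 1 ≤ M.E.ncard) :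
    (M.E.ncard - 1 - k) * lowAbsorbCount M y k ≤ k * lowAbsorbCount M y (k + 1) := by
  rw [lowAbsorbCount_eq_card, lowAbsorbCount_eq_card]
  set Ak := absorbFinset M y k
  set Ak1 := absorbFinset M y (k + 1)
  set n := M.E.ncard with hn
  have hnq : (2 * k + 1 : ℚ) ≤ (n : ℚ) := by exact_mod_cast hk
  have hkq : (1 : ℚ) ≤ k := by exact_mod_cast hk1
  have hposI : (0 : ℚ) < (n : ℚ) - k - 1 := by linarith
  have hS : (Ak.card : ℚ) = ∑ W ∈ Ak1, ∑ Z ∈ downNbrs M y k W, wtk M y k Z := by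
    calc (Ak.card : ℚ) = ∑ Z ∈ Ak, (1 : ℚ) := by simp
      _ = ∑ Z ∈ Ak, ∑ W ∈ Ak1, (if Z ⊆ W then wtk M y k Z else 0) :=
          Finset.sum_congr rfl (fun Z hZ => (sum_wtk_upNbrs M hy hk hZ).symm)
      _ = ∑ W ∈ Ak1, ∑ Z ∈ Ak, (if Z ⊆ W then wtk M y k Z else 0) := Finset.sum_comm
      _ = ∑ W ∈ Ak1, ∑ Z ∈ downNbrs M y k W, wtk M y k Z :=
          Finset.sum_congr rfl (fun W _ => by rw [downNbrs, Finset.sum_filter])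
  have hle : (Ak.card : ℚ) ≤ (Ak1.card : ℚ) * ((k : ℚ) / ((n : ℚ) - k - 1)) := by
    rw [hS]
    calc ∑ W ∈ Ak1, ∑ Z ∈ downNbrs M y k W, wtk M y k Z
        ≤ ∑ W ∈ Ak1, (k : ℚ) / ((n : ℚ) - k - 1) :=
          Finset.sum_le_sum (fun W hW => sum_wtk_downNbrs_le_of_sq M hy hnp hk1 hk hsq hW)
      _ = (Ak1.card : ℚ) * ((k : ℚ) / ((n : ℚ) - k - 1)) := by rw [Finset.sum_const, nsmul_eq_mul]
  have hq : ((n : ℚ) - k - 1) * (Ak.card : ℚ) ≤ (k : ℚ) * (Ak1.card : ℚ) := by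
    have := mul_le_mul_of_nonneg_left hle hposI.le
    rw [mul_comm (Ak1.card : ℚ), ← mul_assoc, mul_div_assoc', mul_comm ((n : ℚ) - k - 1) (k : ℚ),
      mul_div_assoc, div_self hposI.ne', mul_one] at this
    linarith
  have hcast : (((n - 1 - k : ℕ)) : ℚ) = (n : ℚ) - k - 1 := by
    rw [Nat.cast_sub (by omega), Nat.cast_sub (by omega)]; push_cast; ring
  have hq' : (((n - 1 - k) * Ak.card : ℕ) : ℚ) ≤ ((k * Ak1.card : ℕ) : ℚ) := by
    push_cast
    rw [hcast]
    exact hq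
  exact_mod_cast hq'

end PercRepro
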